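import Literature.FieldTheory.AlgClosed.NewtonPuiseuxProofs
import Mathlib.RingTheory.Polynomial.ScaleRoots
import Mathlib.RingTheory.LaurentSeries
import Mathlib.FieldTheory.Separable
import Mathlib.Algebra.Polynomial.Expand
import HarnessLib

/-!
# Formal Puiseux branches of a separable polynomial (all roots as power series)

Topic `Literature/FieldTheory/AlgClosed` (joins `NewtonPuiseux.lean` / `NewtonPuiseuxProofs.lean`).
For an algebraically closed field `k` of characteristic zero and a polynomial
`P(x, y) ∈ k[x][y]` of `y`-degree `d` whose image in `k((x))[y]` is SEPARABLE (equivalently: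
separable over the rational function field `k(x)`), the Newton–Puiseux theorem
(`NewtonPuiseux_holds`: splitting over some `k((x^{1/n}))`) is repackaged in the POLYNOMIAL form
used by convergence arguments: there are a ramification index `n ≥ 1`, a pole order `N` and a set
`S` of `d` DISTINCT formal power series `v ∈ k⟦s⟧` such that the ramified, pole-cleared polynomial
`F̂(s, W) := s^{dN} · P(sⁿ, W/sᴺ) = Σⱼ aⱼ(sⁿ) s^{(d−j)N} Wʲ ∈ k[s][W]`
(Mathlib: `Polynomial.scaleRoots (P.map (expand k n)) (s ^ N)`) factors over `k⟦s⟧` as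
`F̂ = a_d(sⁿ) · ∏_{v ∈ S} (W − v)`. (Kollár, *Lectures on Resolution of Singularities*,
Thm. 1.94 and 1.95; Walker, *Algebraic Curves*, IV §3.)

## Main statements

* `Literature.FieldTheory.AlgClosed.ramify_coePolynomial`: `x = sⁿ` on polynomial
  coefficients is `Polynomial.expand`.
* `Literature.FieldTheory.AlgClosed.exists_formalBranches`: the statement above.

## References

* J. Kollár, *Lectures on Resolution of Singularities*, Ann. of Math. Stud. 166 (2007),
  Thm. 1.94–1.95. [Kollar2007]
* J.-P. Serre, *Local Fields*, GTM 67 (1979), Ch. IV §2, Prop. 8. [Serre1979]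
-/

noncomputable section

namespace Literature.FieldTheory.AlgClosed

open Polynomial
open scoped PowerSeries
open HahnSeries (single ofPowerSeries)
open Literature.Barriers.ResolutionOfSingularities (ramify ramify_single)

variable {k : Type*} [Field k]

/-- The substitution `x = sⁿ` acts on a polynomial coefficient `a(x)` as `Polynomial.expand`:
`a(x) ↦ a(sⁿ)`. [cite: Kollar2007, Thm. 1.94] -/
theorem ramify_coePolynomial (n : ℕ) (hn : 0 < n) (p : k[X]) :
    ramify k n hn (ofPowerSeries ℤ k (p : k⟦X⟧)) =
      ofPowerSeries ℤ k ((Polynomial.expand k n p : k[X]) : k⟦X⟧) := by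
  set ι : k[X] →+* LaurentSeries k :=
    (ofPowerSeries ℤ k).comp (Polynomial.coeToPowerSeries.ringHom : k[X] →+* k⟦X⟧) with hι
  have hιapp : ∀ q : k[X], ι q = ofPowerSeries ℤ k (q : k⟦X⟧) := fun q => rfl
  have key : (ramify k n hn).comp ι = ι.comp (Polynomial.expand k n : k[X] →ₐ[k] k[X]).toRingHom := by
    refine Polynomial.ringHom_ext (fun c => ?_) ?_
    · simp only [RingHom.comp_apply, AlgHom.toRingHom_eq_coe, RingHom.coe_coe, Polynomial.expand_C,
        hιapp, Polynomial.coe_C, HahnSeries.ofPowerSeries_C, HahnSeries.C_apply, ramify_single,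
        mul_zero]
    · simp only [RingHom.comp_apply, AlgHom.toRingHom_eq_coe, RingHom.coe_coe, Polynomial.expand_X,
        hιapp, Polynomial.coe_X, Polynomial.coe_pow, HahnSeries.ofPowerSeries_X,
        HahnSeries.ofPowerSeries_X_pow, ramify_single, mul_one]
  have := congrArg (fun φ : k[X] →+* LaurentSeries k => φ p) key
  simpa only [RingHom.comp_apply, hιapp, AlgHom.toRingHom_eq_coe, RingHom.coe_coe] using this

/-- On polynomials in `y`: mapping the coefficients by `x = sⁿ` is `expand` on each coefficient.
[cite: Kollar2007, Thm. 1.94] -/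
theorem map_ramify_eq_map_expand (n : ℕ) (hn : 0 < n) (P : k[X][X]) :
    (P.map ((ofPowerSeries ℤ k).comp (Polynomial.coeToPowerSeries.ringHom : k[X] →+* k⟦X⟧))).map
        (ramify k n hn) =
      (P.map (Polynomial.expand k n : k[X] →ₐ[k] k[X]).toRingHom).map
        ((ofPowerSeries ℤ k).comp (Polynomial.coeToPowerSeries.ringHom : k[X] →+* k⟦X⟧)) := by
  rw [Polynomial.map_map, Polynomial.map_map]
  congr 1
  refine RingHom.ext fun q => ?_
  simp only [RingHom.comp_apply, AlgHom.toRingHom_eq_coe, RingHom.coe_coe]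
  exact ramify_coePolynomial n hn q

/-- Scaling the roots of a split polynomial: `(c · ∏ (X − y)).scaleRoots r = c · ∏ (X − r·y)`
(over a domain). [folklore] -/
theorem scaleRoots_C_mul_prod_X_sub_C {R : Type*} [CommRing R] [IsDomain R] {ι : Type*}
    (T : Finset ι) (y : ι → R) (c r : R) :
    (Polynomial.C c * ∏ i ∈ T, (Polynomial.X - Polynomial.C (y i))).scaleRoots r =
      Polynomial.C c * ∏ i ∈ T, (Polynomial.X - Polynomial.C (r * y i)) := by
  classical
  induction T using Finset.induction_on with
  | empty => simp
  | insert a s ha ih =>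
    rw [Finset.prod_insert ha, Finset.prod_insert ha, mul_left_comm,
      Polynomial.mul_scaleRoots_of_noZeroDivisors, ih, Polynomial.X_sub_C_scaleRoots, mul_comm r,
      mul_left_comm]

/-- A Laurent series multiplied by a high enough power of the variable is a power series.
[folklore] -/
theorem exists_single_mul_eq_ofPowerSeries (y : LaurentSeries k) (N : ℕ) (hN : -y.order ≤ N) :
    ∃ v : k⟦X⟧, (single (N : ℤ) 1 : LaurentSeries k) * y = ofPowerSeries ℤ k v := by
  obtain ⟨M, hM⟩ : ∃ M : ℕ, (N : ℤ) + y.order = M := ⟨((N : ℤ) + y.order).toNat, by omega⟩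
  refine ⟨PowerSeries.X ^ M * y.powerSeriesPart, ?_⟩
  rw [map_mul, map_pow, HahnSeries.ofPowerSeries_X, LaurentSeries.ofPowerSeries_powerSeriesPart,
    HahnSeries.single_pow, ← mul_assoc, HahnSeries.single_mul_single]
  simp [← hM]

/-- **Formal Puiseux branches.** For `k` algebraically closed of characteristic zero and
`P ∈ k[x][y]` whose image over `k((x))` is separable, there are `n ≥ 1`, `N` and a finite set
`S ⊂ k⟦s⟧` of `natDegree P` distinct power series such that the ramified, pole-cleared polynomial
`F̂(s, W) = s^{dN} P(sⁿ, W/sᴺ)` (= `scaleRoots (P.map (expand k n)) (s^N)`) factors over `k⟦s⟧`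
as `a_d(sⁿ) · ∏_{v ∈ S} (W − v)`. (The field lives in `Type`, as in the tree's `NewtonPuiseux`.)
[cite: Kollar2007, Thm. 1.94] -/
theorem exists_formalBranches {k : Type} [Field k] [IsAlgClosed k] [CharZero k] (P : k[X][X])
    (hsep : (P.map ((ofPowerSeries ℤ k).comp
      (Polynomial.coeToPowerSeries.ringHom : k[X] →+* k⟦X⟧))).Separable) :
    ∃ (n : ℕ) (_ : 0 < n) (N : ℕ) (S : Finset k⟦X⟧), S.card = P.natDegree ∧
      (Polynomial.scaleRoots (P.map (Polynomial.expand k n : k[X] →ₐ[k] k[X]).toRingHom)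
          ((X : k[X]) ^ N)).map (Polynomial.coeToPowerSeries.ringHom : k[X] →+* k⟦X⟧) =
        Polynomial.C (((Polynomial.expand k n P.leadingCoeff : k[X]) : k⟦X⟧)) *
          ∏ v ∈ S, (Polynomial.X - Polynomial.C v) := by
  classical
  set ι₀ : k[X] →+* k⟦X⟧ := Polynomial.coeToPowerSeries.ringHom with hι₀
  set ι : k[X] →+* LaurentSeries k := (ofPowerSeries ℤ k).comp ι₀ with hι
  have hιinj : Function.Injective ι :=
    HahnSeries.ofPowerSeries_injective.comp (Polynomial.coe_injective k)
  -- Newton–Puiseux: after `x = sⁿ` the image splits over `k((s))`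
  obtain ⟨n, hn, hsplit⟩ := NewtonPuiseux_holds k (P.map ι)
  set Pn : k[X][X] := P.map (Polynomial.expand k n : k[X] →ₐ[k] k[X]).toRingHom with hPn
  set Fn : (LaurentSeries k)[X] := Pn.map ι with hFn
  have hFn' : (P.map ι).map (ramify k n hn) = Fn := map_ramify_eq_map_expand n hn P
  rw [hFn'] at hsplit
  have hsepn : Fn.Separable := by rw [← hFn']; exact hsep.map
  have hnodup : Fn.roots.Nodup := Polynomial.nodup_roots hsepn
  -- leading coefficient and degree
  have hexpinj : Function.Injective (Polynomial.expand k n : k[X] →ₐ[k] k[X]).toRingHom :=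
    Polynomial.expand_injective hn
  have hlcPn : Pn.leadingCoeff = Polynomial.expand k n P.leadingCoeff := by
    rw [hPn, Polynomial.leadingCoeff_map_of_injective hexpinj]; rfl
  have hdegPn : Pn.natDegree = P.natDegree := by
    rw [hPn, Polynomial.natDegree_map_eq_of_injective hexpinj]
  have hlcFn : Fn.leadingCoeff = ι Pn.leadingCoeff := by
    rw [hFn, Polynomial.leadingCoeff_map_of_injective hιinj]
  have hdegFn : Fn.natDegree = P.natDegree := by
    rw [hFn, Polynomial.natDegree_map_eq_of_injective hιinj, hdegPn]
  have hlc0 : ι Pn.leadingCoeff ≠ 0 := by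
    rw [← hlcFn]; exact Polynomial.leadingCoeff_ne_zero.mpr hsepn.ne_zero
  set T : Finset (LaurentSeries k) := Fn.roots.toFinset with hT
  have hcard : T.card = P.natDegree := by
    rw [hT, Multiset.toFinset_card_of_nodup hnodup, ← hsplit.natDegree_eq_card_roots, hdegFn]
  -- the product formula over `k((s))`
  have hprod : Fn = Polynomial.C (ι Pn.leadingCoeff) * ∏ y ∈ T, (Polynomial.X - Polynomial.C y) := by
    conv_lhs => rw [hsplit.eq_prod_roots]
    rw [hlcFn, Finset.prod_eq_multiset_prod, hT, Multiset.toFinset_val, hnodup.dedup]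
  -- pole clearing
  set N : ℕ := T.sup fun y => (-y.order).toNat with hN
  have hNle : ∀ y ∈ T, -y.order ≤ (N : ℤ) := by
    intro y hy
    have h1 : (-y.order).toNat ≤ N := Finset.le_sup (f := fun y => (-y.order).toNat) hy
    omega
  have hv : ∀ y : LaurentSeries k, ∃ v : k⟦X⟧, y ∈ T →
      (single (N : ℤ) 1 : LaurentSeries k) * y = ofPowerSeries ℤ k v := by
    intro y
    by_cases hy : y ∈ T
    · obtain ⟨v, hv⟩ := exists_single_mul_eq_ofPowerSeries y N (hNle y hy)
      exact ⟨v, fun _ => hv⟩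
    · exact ⟨0, fun h => absurd h hy⟩
  choose v hv using hv
  have hvinj : Set.InjOn v (T : Set (LaurentSeries k)) := by
    intro y hy y' hy' h
    have h1 : (single (N : ℤ) 1 : LaurentSeries k) * y = single (N : ℤ) 1 * y' := by
      rw [hv y hy, hv y' hy', h]
    have hunit : (single (N : ℤ) (1 : k) : LaurentSeries k) ≠ 0 := by
      rw [Ne, HahnSeries.single_eq_zero_iff]; exact one_ne_zero
    exact mul_left_cancel₀ hunit h1
  have hιX : ι X = single 1 1 := by
    rw [hι, RingHom.comp_apply, hι₀]
    change ofPowerSeries ℤ k ((X : k[X]) : k⟦X⟧) = single 1 1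
    rw [Polynomial.coe_X, HahnSeries.ofPowerSeries_X]
  refine ⟨n, hn, N, T.image v, ?_, ?_⟩
  · rw [Finset.card_image_of_injOn hvinj, hcard]
  · -- map the claimed identity injectively into `k((s))[X]`
    apply Polynomial.map_injective (ofPowerSeries ℤ k) HahnSeries.ofPowerSeries_injective
    rw [Polynomial.map_map, ← hι, Polynomial.map_scaleRoots _ _ _ hlc0, ← hFn, map_pow, hιX,
      HahnSeries.single_pow, one_pow, hprod, scaleRoots_C_mul_prod_X_sub_C, Polynomial.map_mul,
      Polynomial.map_C, Polynomial.map_prod, Finset.prod_image hvinj]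
    congr 1
    · rw [hlcPn]; rfl
    · refine Finset.prod_congr rfl fun y hy => ?_
      rw [Polynomial.map_sub, Polynomial.map_X, Polynomial.map_C, ← hv y hy]
      simp

end Literature.FieldTheory.AlgClosed

end
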